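import Literature.Analysis.ODE.GlobalExistence
import Literature.Analysis.ODE.PeriodicDissipative
import HarnessLib

/-!
# Finite-dimensional systems of Navier–Stokes type cannot blow up: global existence from the energy
# identity

Topic `Literature/Analysis/ODE` (namespace `Literature.Analysis.ODE`). Everything PROVED; no definition,
no named fact.

For a finite-dimensional real inner product space `E`, a linear `A : E →L E` that is COERCIVE
(`m‖x‖² ≤ ⟪Ax, x⟫`, `m > 0`), a continuous bilinear `B : E →L E →L E` with the ENERGY CANCELLATION
`⟪B(x,x), x⟫ = 0`, and a bounded continuous force `f` (`‖f(t)‖ ≤ M`), the system of «Navier–Stokes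
type»

  `u' + A u + B(u,u) = f(t)`

has, from EVERY initial state `u₀`, a solution on `[0, ∞)`, and it obeys the absorbing-ball bound
`‖u(t)‖² ≤ max (M²/m², ‖u₀‖²)` for all `t ≥ 0`. Proof: `⟪f − Au − B(u,u), u⟫ ≤ M‖u‖ − m‖u‖²
≤ M²/(2m) − (m/2)‖u‖²` (the cancellation kills the quadratic term), so the ball `‖u‖² ≤ C/δ` is forward
invariant (tree `ODE.norm_sq_le_of_dissipative`); the field is Lipschitz on balls (linear + bilinear), so
the continuation principle in a-priori-bound form (tree `ODE.exists_solution_of_apriori_bound`) gives a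
global solution. This is the classical global existence of Galerkin approximations (Constantin–Foias 1988,
Ch. 8, (8.5)–(8.9): «the Galerkin system … is a quadratic, constant coefficient ODE system … by the energy
equation the solution exists for all time»; Robinson–Rodrigo–Sadowski 2016, Thm. 4.4 Steps 1–2; Temam
1977, Ch. III §3.2), stated here once for the ABSTRACT operator class rather than for the Fourier–Galerkin
coefficients (tree `Literature.Analysis.FluidPDE.NS.energy_apriori_bound`, `NS.exists_galerkin_solution`,
which are the torus instance).

Why it is recorded (cell ns-claims, D-0090 map, technique row T2 «abstract operator theorems»): every
FINITE-dimensional system meeting the energy-class hypotheses of an abstract «Navier–Stokes type» theorem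
(e.g. the hypotheses (У.1)–(У.4) of Otelbaev 2013, claim C01 `Otelbaev2013`, or Conditions A, B1–B3 of its
Theorem 2) is globally solvable, so a finite-dimensional countermodel to such a theorem can only refute a
QUANTITATIVE conclusion (constants uniform in the system), never qualitative existence — which is why the
2014 countermodels to Otelbaev's Theorem 6.1 [cite: MontgomerySmith2014Otelbaev, Update 2] are families with
dimension-free constants, and why qualitative blow-up models for the class are infinite-dimensional
(Tao 2016, tree `Literature.Barriers.NavierStokesRegularity.TaoAveragedBlowup`).

* `lipschitzOnWith_quadraticField` — `x ↦ c − Ax − B(x,x)` is Lipschitz on `‖x‖ ≤ ρ` with constant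
  `‖A‖ + 2ρ‖B‖`;
* `inner_quadraticField_self_le` — the energy inequality `⟪c − Ax − B(x,x), x⟫ ≤ M²/(2m) − (m/2)‖x‖²`;
* `norm_sq_le_of_energyClass_solution` — the a priori bound along any solution on `[a, b]`;
* `exists_global_solution_of_energyClass` — global existence on `[0, ∞)` with the bound.

## Mathlib / tree search
Mathlib: local Picard–Lindelöf only. Tree: `ODE.exists_solution_of_apriori_bound` (GlobalExistence),
`ODE.norm_sq_le_of_dissipative` and `ODE.exists_solution_eq_endpoints_of_dissipative` (PeriodicDissipative
— periodic orbits of dissipative fields; its global-existence step is internal), `NS.exists_galerkin_solution`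
(torus Galerkin coefficients), `ODE.exists_global_solution_of_sublevel` (Lyapunov sublevel sets; autonomous).
No abstract statement for the operator class `(A coercive, B energy-neutral)` was found
(`lean search 'exists_global_solution|energyClass|cancellation.*global'`).

## References
* P. Constantin, C. Foias, *Navier–Stokes Equations*, Univ. of Chicago Press 1988, Ch. 8 (8.5)–(8.9).
  [ConstantinFoiasNSE1988]
* J. C. Robinson, J. L. Rodrigo, W. Sadowski, *The Three-Dimensional Navier–Stokes Equations*, CUP 2016,
  Thm. 4.4, Steps 1–2. [RobinsonRodrigoSadowski2016]
* S. Montgomery-Smith (relaying T. Tao), Math.SE answer 649373 (2014), Update 2. [MontgomerySmith2014Otelbaev]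

WHAT THIS IS NOT: not a claim about NS regularity or blow-up; not a claim about any author beyond the
typed locator.
-/

noncomputable section

open Set Metric Filter Topology
open scoped NNReal RealInnerProductSpace

namespace Literature.Analysis.ODE

variable {E : Type*} [NormedAddCommGroup E] [InnerProductSpace ℝ E]

/-- **The quadratic field is Lipschitz on balls**: for `‖x‖, ‖y‖ ≤ ρ`,
`‖(c − Ax − B(x,x)) − (c − Ay − B(y,y))‖ ≤ (‖A‖ + 2ρ‖B‖) ‖x − y‖`
(`B(x,x) − B(y,y) = B(x, x−y) + B(x−y, y)`; the «locally Lipschitz right-hand side» of the Galerkin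
system). [cite: RobinsonRodrigoSadowski2016, Thm. 4.4 Step 1] -/
theorem lipschitzOnWith_quadraticField (A : E →L[ℝ] E) (B : E →L[ℝ] E →L[ℝ] E) (c : E) {ρ : ℝ}
    (hρ : 0 ≤ ρ) :
    LipschitzOnWith (Real.toNNReal (‖A‖ + 2 * ρ * ‖B‖)) (fun x => c - A x - B x x)
      (closedBall (0 : E) ρ) := by
  refine LipschitzOnWith.of_dist_le_mul fun x hx y hy => ?_
  rw [mem_closedBall, dist_zero_right] at hx hy
  have hK : 0 ≤ ‖A‖ + 2 * ρ * ‖B‖ := by positivity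
  rw [Real.coe_toNNReal _ hK, dist_eq_norm, dist_eq_norm]
  have h1 : (c - A x - B x x) - (c - A y - B y y) = -(A (x - y)) - (B x (x - y) + B (x - y) y) := by
    simp only [map_sub, FunLike.coe_sub, Pi.sub_apply]
    abel
  rw [h1]
  have hA : ‖A (x - y)‖ ≤ ‖A‖ * ‖x - y‖ := A.le_opNorm _
  have hB1 : ‖B x (x - y)‖ ≤ ‖B‖ * ‖x‖ * ‖x - y‖ := B.le_opNorm₂ x (x - y)
  have hB2 : ‖B (x - y) y‖ ≤ ‖B‖ * ‖x - y‖ * ‖y‖ := B.le_opNorm₂ (x - y) y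
  have hB0 : 0 ≤ ‖B‖ := norm_nonneg B
  have hxy : 0 ≤ ‖x - y‖ := norm_nonneg _
  calc ‖-(A (x - y)) - (B x (x - y) + B (x - y) y)‖
      ≤ ‖A (x - y)‖ + (‖B x (x - y)‖ + ‖B (x - y) y‖) := by
        refine (norm_sub_le _ _).trans ?_
        rw [norm_neg]
        exact add_le_add le_rfl (norm_add_le _ _)
    _ ≤ ‖A‖ * ‖x - y‖ + (‖B‖ * ρ * ‖x - y‖ + ‖B‖ * ‖x - y‖ * ρ) := by
        gcongr
        · calc ‖B x (x - y)‖ ≤ ‖B‖ * ‖x‖ * ‖x - y‖ := hB1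
            _ ≤ ‖B‖ * ρ * ‖x - y‖ := by gcongr
        · calc ‖B (x - y) y‖ ≤ ‖B‖ * ‖x - y‖ * ‖y‖ := hB2
            _ ≤ ‖B‖ * ‖x - y‖ * ρ := by gcongr
    _ = (‖A‖ + 2 * ρ * ‖B‖) * ‖x - y‖ := by ring

/-- **Energy inequality of the quadratic field**: if `m‖x‖² ≤ ⟪Ax, x⟫` (`m > 0`), `⟪B(x,x), x⟫ = 0`
and `‖c‖ ≤ M`, then `⟪c − Ax − B(x,x), x⟫ ≤ M²/(2m) − (m/2)‖x‖²` (Young: `M‖x‖ ≤ M²/(2m) + (m/2)‖x‖²`).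
[cite: ConstantinFoiasNSE1988, Ch. 8 (8.7)–(8.9)] -/
theorem inner_quadraticField_self_le {A : E →L[ℝ] E} {B : E →L[ℝ] E →L[ℝ] E} {m M : ℝ} (hm : 0 < m)
    (hA : ∀ x : E, m * ‖x‖ ^ 2 ≤ ⟪A x, x⟫) (hB : ∀ x : E, ⟪B x x, x⟫ = 0) {c : E} (hc : ‖c‖ ≤ M)
    (x : E) : ⟪c - A x - B x x, x⟫ ≤ M ^ 2 / (2 * m) - m / 2 * ‖x‖ ^ 2 := by
  rw [inner_sub_left, inner_sub_left, hB x, sub_zero]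
  have h1 : ⟪c, x⟫ ≤ M * ‖x‖ :=
    (real_inner_le_norm c x).trans (mul_le_mul_of_nonneg_right hc (norm_nonneg _))
  have h2 : M * ‖x‖ ≤ M ^ 2 / (2 * m) + m / 2 * ‖x‖ ^ 2 := by
    have hx : 0 ≤ ‖x‖ := norm_nonneg _
    have : 0 ≤ (M - m * ‖x‖) ^ 2 := sq_nonneg _
    have hm' : 0 < 2 * m := by linarith
    rw [div_add' _ _ _ hm'.ne', le_div_iff₀ hm']
    nlinarith
  linarith [hA x]

/-- **A priori bound along a solution**: under the hypotheses of `inner_quadraticField_self_le` with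
`‖f t‖ ≤ M` for all `t`, any solution of `u' = f(t) − Au − B(u,u)` on `[a, b]` with
`‖u(a)‖² ≤ max (M²/m²) R` stays in that ball: `‖u(t)‖² ≤ max (M²/m²) R` on `[a, b]`
(tree `ODE.norm_sq_le_of_dissipative` with `C = max (M²/(2m)) ((m/2)R)`, `δ = m/2`).
[cite: RobinsonRodrigoSadowski2016, Thm. 4.4 Step 2] -/
theorem norm_sq_le_of_energyClass_solution {A : E →L[ℝ] E} {B : E →L[ℝ] E →L[ℝ] E} {m M : ℝ}
    (hm : 0 < m) (hA : ∀ x : E, m * ‖x‖ ^ 2 ≤ ⟪A x, x⟫) (hB : ∀ x : E, ⟪B x x, x⟫ = 0)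
    {f : ℝ → E} (hf : ∀ t, ‖f t‖ ≤ M) {R a b : ℝ} {u : ℝ → E}
    (hu : ∀ t ∈ Icc a b, HasDerivWithinAt u (f t - A (u t) - B (u t) (u t)) (Icc a b) t)
    (ha : ‖u a‖ ^ 2 ≤ max (M ^ 2 / m ^ 2) R) :
    ∀ t ∈ Icc a b, ‖u t‖ ^ 2 ≤ max (M ^ 2 / m ^ 2) R := by
  set C : ℝ := max (M ^ 2 / (2 * m)) (m / 2 * R) with hC
  have hδ : 0 < m / 2 := by linarith
  have hCδ : C / (m / 2) = max (M ^ 2 / m ^ 2) R := by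
    rw [hC, div_eq_mul_inv, max_mul_of_nonneg _ _ (inv_nonneg.2 hδ.le)]
    congr 1
    · field_simp
    · field_simp
  have hdiss : ∀ t x, ⟪(fun t x => f t - A x - B x x) t x, x⟫ ≤ C - m / 2 * ‖x‖ ^ 2 := by
    intro t x
    refine (inner_quadraticField_self_le hm hA hB (hf t) x).trans ?_
    have : M ^ 2 / (2 * m) ≤ C := le_max_left _ _
    linarith
  have ha' : ‖u a‖ ^ 2 ≤ C / (m / 2) := by rw [hCδ]; exact ha
  intro t ht
  rw [← hCδ]
  exact norm_sq_le_of_dissipative hδ hdiss hu ha' t ht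

variable [FiniteDimensional ℝ E]

/-- **Global existence for finite-dimensional systems of Navier–Stokes type.** Let `E` be a
finite-dimensional real inner product space, `A : E →L E` coercive (`m‖x‖² ≤ ⟪Ax, x⟫`, `m > 0`),
`B : E →L E →L E` bilinear with the energy cancellation `⟪B(x,x), x⟫ = 0`, and `f : ℝ → E` continuous
with `‖f(t)‖ ≤ M`. Then for every `u₀` there is `u : ℝ → E` with `u 0 = u₀` solving
`u' = f(t) − Au − B(u,u)` on `[0, T]` for every `T` (one-sided derivatives at the endpoints), and
`‖u(t)‖² ≤ max (M²/m², ‖u₀‖²)` for all `t ≥ 0`. In particular no such system blows up in finite time: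
a finite-dimensional countermodel to an abstract «Navier–Stokes type» theorem with these energy-class
hypotheses can refute only dimension-uniform QUANTITATIVE conclusions.
[cite: ConstantinFoiasNSE1988, Ch. 8 (8.5)–(8.9)] -/
theorem exists_global_solution_of_energyClass (A : E →L[ℝ] E) (B : E →L[ℝ] E →L[ℝ] E) {m M : ℝ}
    (hm : 0 < m) (hA : ∀ x : E, m * ‖x‖ ^ 2 ≤ ⟪A x, x⟫) (hB : ∀ x : E, ⟪B x x, x⟫ = 0)
    {f : ℝ → E} (hfc : Continuous f) (hf : ∀ t, ‖f t‖ ≤ M) (u₀ : E) :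
    ∃ u : ℝ → E, u 0 = u₀ ∧
      (∀ T : ℝ, ∀ t ∈ Icc 0 T, HasDerivWithinAt u (f t - A (u t) - B (u t) (u t)) (Icc 0 T) t) ∧
      ∀ t : ℝ, 0 ≤ t → ‖u t‖ ^ 2 ≤ max (M ^ 2 / m ^ 2) (‖u₀‖ ^ 2) := by
  haveI : CompleteSpace E := FiniteDimensional.complete ℝ E
  set v : ℝ → E → E := fun t x => f t - A x - B x x with hv
  -- Lipschitz on balls, uniformly in time
  have hlip : ∀ T ρ : ℝ, ∃ K : ℝ≥0, ∀ t ∈ Icc 0 T, LipschitzOnWith K (v t) (closedBall 0 ρ) := by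
    intro T ρ
    refine ⟨Real.toNNReal (‖A‖ + 2 * max ρ 0 * ‖B‖), fun t _ => ?_⟩
    exact (lipschitzOnWith_quadraticField A B (f t) (le_max_right ρ 0)).mono
      (closedBall_subset_closedBall (le_max_left ρ 0))
  have hcont : ∀ x, ContinuousOn (v · x) (Ici 0) := fun x =>
    ((hfc.sub continuous_const).sub continuous_const).continuousOn
  -- the a priori bound: radius `R₀ = √(max (M²/m²) ‖u₀‖²)`
  set R₀ : ℝ := Real.sqrt (max (M ^ 2 / m ^ 2) (‖u₀‖ ^ 2)) with hR₀
  have hsq0 : 0 ≤ max (M ^ 2 / m ^ 2) (‖u₀‖ ^ 2) := le_max_of_le_right (sq_nonneg _)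
  have hu₀R : ‖u₀‖ ≤ R₀ := by
    rw [hR₀]
    calc ‖u₀‖ = Real.sqrt (‖u₀‖ ^ 2) := (Real.sqrt_sq (norm_nonneg u₀)).symm
      _ ≤ Real.sqrt (max (M ^ 2 / m ^ 2) (‖u₀‖ ^ 2)) := Real.sqrt_le_sqrt (le_max_right _ _)
  have hapriori : ∀ T : ℝ, 0 ≤ T → ∃ R : ℝ, ‖u₀‖ ≤ R ∧ ∀ s ∈ Icc 0 T, ∀ α : ℝ → E, α 0 = u₀ →
      (∀ t ∈ Icc 0 s, HasDerivWithinAt α (v t (α t)) (Icc 0 s) t) → ∀ t ∈ Icc 0 s, ‖α t‖ ≤ R := by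
    intro T _
    refine ⟨R₀, hu₀R, fun s _ α hα0 hα t ht => ?_⟩
    have hb := norm_sq_le_of_energyClass_solution hm hA hB hf (R := ‖u₀‖ ^ 2) hα
      (by rw [hα0]; exact le_max_right _ _) t ht
    rw [hR₀]
    calc ‖α t‖ = Real.sqrt (‖α t‖ ^ 2) := (Real.sqrt_sq (norm_nonneg (α t))).symm
      _ ≤ Real.sqrt (max (M ^ 2 / m ^ 2) (‖u₀‖ ^ 2)) := Real.sqrt_le_sqrt hb
  obtain ⟨u, hu0, hu⟩ := exists_solution_of_apriori_bound hlip hcont hapriori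
  refine ⟨u, hu0, hu, fun t ht => ?_⟩
  exact norm_sq_le_of_energyClass_solution hm hA hB hf (R := ‖u₀‖ ^ 2) (hu t)
    (by rw [hu0]; exact le_max_right _ _) t ⟨ht, le_rfl⟩

end Literature.Analysis.ODE

end
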